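import Mathlib
import Literature.Computability.AlgebraicComplexity.StandardFamilies
import Literature.Computability.AlgebraicComplexity.DeterminantalComplexity
import Literature.RingTheory.MvPolynomial.BihomogeneousCoefficients
import Summits.ValiantsHypothesis.ValiantsHypothesis.Theorems.RefutationDegreeDefs
import Summits.ValiantsHypothesis.ValiantsHypothesis.Theorems.RefutationDegreeRefutationBarrierPencilCoeff
import Summits.ValiantsHypothesis.ValiantsHypothesis.Theorems.RefutationDegreeRefutationBarrierStubBorderGapDichotomyAux

/-!
# Crux `RefutationBarrier` (stmt-ValiantsHypothesis-5642), line `Sketch_ideator5`, stub D1: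
the BORDER-GAP DICHOTOMY (card `balanced-singular-limits`, Kempf–Ness confinement of border gaps)

If `per_n` is in the affine border at size `m` (`InBorder n m`: every `x`-coefficient of
`det(A₀ + Σ_e x_e A_e) − per_n` tends to `0` along a sequence of tuples `A^{(k)}`), then EITHER
`per_n` has an exact affine determinantal expression of size `m`, OR there is a sup-norm-one tuple
`W = (W₀, (W_e)_e)` of `m × m` matrices which is BALANCED (`Σ_t W_t W_tᴴ = α·1 = Σ_t W_tᴴ W_t`) and
SINGULAR (`det(W₀ + Σ_e x_e W_e) ≡ 0`) — `stub_border_gap_dichotomy` (registered stub D1 of the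
lead skeleton of line `Sketch_ideator5`).

Proof (elementary; no Lie theory, no derivatives).
* Matrix families (§1 = the auxiliary file `…StubBorderGapDichotomyAux.lean`).  For a finite
  family `M : ι → Matrix (Fin m) (Fin m) ℂ` with energy `E(M) = Σ_t ‖M_t‖_F²`: if `E` does not
  decrease under LEFT multiplication by matrices of determinant one, testing with the
  transvections `1 + s E_{ij}` (`s ∈ ℂ`) and the diagonal matrices `diag(…, c, …, c⁻¹, …)`
  (`c > 0`) gives the first-order (moment-map) conditions — `Σ_t M_t M_tᴴ` has zero
  off-diagonal and equal diagonal entries (`borderGap_left_firstOrder`; the two scalar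
  lemmas `borderGap_eq_zero_of_forall_re`, `borderGap_le_of_forall_sq` extract them from the
  inequalities); the RIGHT version follows by transposing (`borderGap_right_firstOrder`), and with
  the trace identity `tr Σ_t M_t M_tᴴ = E` the family is balanced,
  `Σ_t M_t M_tᴴ = (E/m)·1 = Σ_t M_tᴴ M_t` (`borderGap_family_balanced`).
* Tuples (§2).  `Φ_μ(W) :=` the `x^μ`-coefficient of `det(W₀ + Σ_e x_e W_e)` is a form of degree
  `m` in `W` (`isHomogeneous_coeff_det_pencil`), invariant under `W_t ↦ g W_t h` for
  `det g = det h = 1` (`borderGap_phi_lact`, `borderGap_phi_ract`: `det` is multiplicative over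
  `ℂ[x]`).  On the closed fibre `{Φ = Φ(A)}` the coercive energy `Σ_u |W u|²` attains its minimum
  (`borderGap_exists_min`); the fibre is stable under the action, so §1 applies and the minimiser
  is balanced (`borderGap_exists_balanced`).
* Dichotomy (§3).  Replace each `A^{(k)}` by a balanced `B^{(k)}` in its fibre.  If the `B^{(k)}`
  are bounded, a convergent subsequence has a limit `L` with
  `Φ_μ(L) = lim Φ_μ(A^{(k)}) = coeff_μ per_n` for all `μ`, i.e. `det(L₀ + Σ x_e L_e) = per_n`
  (`borderGap_hasDetRepr`).  Otherwise normalise a subsequence with `‖B^{(k)}‖ → ∞` to the unit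
  sphere: balance is homogeneous (`borderGap_balanced_smul`), `Φ_μ(B/‖B‖) = ‖B‖^{-m} Φ_μ(A) → 0`,
  and a limit point on the compact sphere is norm-one, balanced (a closed condition) and singular.

References: Kempf–Ness 1979 (minimal vectors); Gurvits 2004 and Garg–Gurvits–Oliveira–Wigderson
2016 (operator scaling: balanced = doubly stochastic tuples); Landsberg–Manivel–Ressayre 2013
(border determinantal complexity).  Everything in this file is folklore.
-/

set_option linter.dupNamespace false

noncomputable section

namespace Summit.ValiantsHypothesis.ValiantsHypothesis.Theorems.RefutationDegree

open scoped BigOperators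
open Filter Topology MvPolynomial Matrix
open Literature.Computability.AlgebraicComplexity (perPoly HasDetRepr)
open Literature.RingTheory.MvPolynomial (eval_smul_of_isHomogeneous)

/-! ## §2 Tuples: the coefficient functions `Φ_μ` and balanced points of their fibres

(§1, the first-order conditions for matrix families, is the auxiliary file
`RefutationDegreeRefutationBarrierStubBorderGapDichotomyAux.lean`.)

### Notation -/

/-- `Mat[W, t]` (local notation, not a definition): the `m × m` matrix with tag `t` of the tuple
`W : Unk n m → ℂ` (`t = none` for `W₀`, `t = some e` for `W_e`). -/
local notation3 (prettyPrint := false) "Mat[" W ", " t "]" =>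
  Matrix.of fun i j => W (t, (i, j))

/-- `En[W]` (local notation, not a definition): the energy `Σ_u |W u|²` of a tuple. -/
local notation3 (prettyPrint := false) "En[" W "]" => ∑ u, ‖W u‖ ^ 2

variable {n m : ℕ}

/-! ### Invariance of `Φ_μ` and exact expressions -/

/-- The generic pencil with its unknowns evaluated at the tuple `W`: `A_W(x) = W₀ + Σ_e x_e W_e`
as a matrix over `ℂ[x]`. [folklore] -/
private theorem borderGap_pencil_map (W : Unk n m → ℂ) :
    (pencil n m).map (MvPolynomial.map (eval W)) =
      (Mat[W, none]).map C +
        ∑ e : Fin n × Fin n, (X e : MvPolynomial (Fin n × Fin n) ℂ) • (Mat[W, some e]).map C := by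
  funext i j
  simp only [Matrix.map_apply, pencil, Matrix.of_apply, map_add, map_sum, map_mul, map_X, map_C,
    eval_X, Matrix.add_apply, Matrix.sum_apply, Matrix.smul_apply, smul_eq_mul]

/-- `Φ_μ(W) = eval W F_μ` is the `x^μ`-coefficient of `det A_W(x)`. [folklore] -/
private theorem borderGap_phi_eq_coeff (W : Unk n m → ℂ) (μ : (Fin n × Fin n) →₀ ℕ) :
    eval W (((pencil n m).det).coeff μ) =
      (((pencil n m).map (MvPolynomial.map (eval W))).det).coeff μ := by
  rw [← RingHom.mapMatrix_apply, ← RingHom.map_det, coeff_map]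

/-- LEFT invariance: `Φ_μ(g • W) = det g · Φ_μ(W)` for `(g • W)_t = g W_t`. [folklore] -/
private theorem borderGap_phi_lact (g : Matrix (Fin m) (Fin m) ℂ) (W : Unk n m → ℂ)
    (μ : (Fin n × Fin n) →₀ ℕ) :
    eval (fun u : Unk n m => (g * Mat[W, u.1]) u.2.1 u.2.2) (((pencil n m).det).coeff μ) =
      g.det * eval W (((pencil n m).det).coeff μ) := by
  have hM : ∀ t, Mat[(fun u : Unk n m => (g * Mat[W, u.1]) u.2.1 u.2.2), t] = g * Mat[W, t] :=
    fun t => rfl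
  rw [borderGap_phi_eq_coeff, borderGap_phi_eq_coeff, borderGap_pencil_map, borderGap_pencil_map]
  simp only [hM]
  have hfac : (g * Mat[W, none]).map (C : ℂ →+* MvPolynomial (Fin n × Fin n) ℂ) +
      ∑ e : Fin n × Fin n, (X e : MvPolynomial (Fin n × Fin n) ℂ) •
        (g * Mat[W, some e]).map (C : ℂ →+* MvPolynomial (Fin n × Fin n) ℂ) =
        g.map C * ((Mat[W, none]).map (C : ℂ →+* MvPolynomial (Fin n × Fin n) ℂ) +
          ∑ e : Fin n × Fin n, (X e : MvPolynomial (Fin n × Fin n) ℂ) •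
            (Mat[W, some e]).map (C : ℂ →+* MvPolynomial (Fin n × Fin n) ℂ)) := by
    rw [Matrix.mul_add, Finset.mul_sum, Matrix.map_mul]
    congr 1
    refine Finset.sum_congr rfl fun e _ => ?_
    rw [Matrix.map_mul, Matrix.mul_smul]
  rw [hfac, Matrix.det_mul, show (g.map C).det = C g.det from (RingHom.map_det C g).symm,
    coeff_C_mul]

/-- RIGHT invariance: `Φ_μ(W • h) = det h · Φ_μ(W)` for `(W • h)_t = W_t h`. [folklore] -/
private theorem borderGap_phi_ract (h : Matrix (Fin m) (Fin m) ℂ) (W : Unk n m → ℂ)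
    (μ : (Fin n × Fin n) →₀ ℕ) :
    eval (fun u : Unk n m => (Mat[W, u.1] * h) u.2.1 u.2.2) (((pencil n m).det).coeff μ) =
      h.det * eval W (((pencil n m).det).coeff μ) := by
  have hM : ∀ t, Mat[(fun u : Unk n m => (Mat[W, u.1] * h) u.2.1 u.2.2), t] = Mat[W, t] * h :=
    fun t => rfl
  rw [borderGap_phi_eq_coeff, borderGap_phi_eq_coeff, borderGap_pencil_map, borderGap_pencil_map]
  simp only [hM]
  have hfac : (Mat[W, none] * h).map (C : ℂ →+* MvPolynomial (Fin n × Fin n) ℂ) +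
      ∑ e : Fin n × Fin n, (X e : MvPolynomial (Fin n × Fin n) ℂ) •
        (Mat[W, some e] * h).map (C : ℂ →+* MvPolynomial (Fin n × Fin n) ℂ) =
        ((Mat[W, none]).map (C : ℂ →+* MvPolynomial (Fin n × Fin n) ℂ) +
          ∑ e : Fin n × Fin n, (X e : MvPolynomial (Fin n × Fin n) ℂ) •
            (Mat[W, some e]).map (C : ℂ →+* MvPolynomial (Fin n × Fin n) ℂ)) *
            h.map C := by
    rw [Matrix.add_mul, Finset.sum_mul, Matrix.map_mul]
    congr 1
    refine Finset.sum_congr rfl fun e _ => ?_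
    rw [Matrix.map_mul, Matrix.smul_mul]
  rw [hfac, Matrix.det_mul, show (h.map C).det = C h.det from (RingHom.map_det C h).symm,
    mul_comm, coeff_C_mul]

/-- A tuple on which every `Φ_μ` takes the value `coeff_μ per_n` IS an affine determinantal
expression of `per_n` of size `m`. [folklore] -/
private theorem borderGap_hasDetRepr (W : Unk n m → ℂ)
    (h : ∀ μ, eval W (((pencil n m).det).coeff μ) = coeff μ (perPoly (Fin n) ℂ)) :
    HasDetRepr (perPoly (Fin n) ℂ) m := by
  refine ⟨(pencil n m).map (MvPolynomial.map (eval W)), fun i j => ?_, ?_⟩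
  · simp only [Matrix.map_apply, pencil, Matrix.of_apply, map_add, map_sum, map_mul, map_X, map_C]
    refine (totalDegree_add _ _).trans (max_le ?_ ?_)
    · rw [totalDegree_C]
      exact Nat.zero_le _
    · refine totalDegree_finsetSum_le fun e _ => (totalDegree_mul _ _).trans ?_
      rw [totalDegree_C, add_zero, totalDegree_X]
  · exact MvPolynomial.ext _ _ fun μ => by rw [← borderGap_phi_eq_coeff, h]

/-! ### Minimal-energy points of the fibres of `Φ` are balanced -/

/-- The energy attains its minimum on every fibre `{Φ = Φ(A)}` (closed, and the energy is
coercive on the finite-dimensional space of tuples). [folklore] -/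
private theorem borderGap_exists_min (A : Unk n m → ℂ) :
    ∃ B : Unk n m → ℂ,
      (∀ μ, eval B (((pencil n m).det).coeff μ) = eval A (((pencil n m).det).coeff μ)) ∧
      ∀ W : Unk n m → ℂ,
        (∀ μ, eval W (((pencil n m).det).coeff μ) = eval A (((pencil n m).det).coeff μ)) →
          En[B] ≤ En[W] := by
  set O : Set (Unk n m → ℂ) :=
    {W | ∀ μ, eval W (((pencil n m).det).coeff μ) = eval A (((pencil n m).det).coeff μ)} with hO
  have hOc : IsClosed O := by
    rw [hO, Set.setOf_forall]
    exact isClosed_iInter fun μ => isClosed_eq (MvPolynomial.continuous_eval _) continuous_const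
  have hcont : Continuous fun W : Unk n m → ℂ => En[W] :=
    continuous_finsetSum _ fun u _ => ((continuous_apply u).norm).pow 2
  have hbound : ∀ W : Unk n m → ℂ, ‖W‖ ^ 2 ≤ En[W] := by
    intro W
    have h1 : ‖W‖ ≤ Real.sqrt (En[W]) := by
      refine (pi_norm_le_iff_of_nonneg (Real.sqrt_nonneg _)).mpr fun u => ?_
      rw [← Real.sqrt_sq (norm_nonneg (W u))]
      exact Real.sqrt_le_sqrt
        (Finset.single_le_sum (fun v _ => sq_nonneg ‖W v‖) (Finset.mem_univ u))
    calc ‖W‖ ^ 2 ≤ Real.sqrt (En[W]) ^ 2 := pow_le_pow_left₀ (norm_nonneg _) h1 2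
      _ = En[W] := Real.sq_sqrt (Finset.sum_nonneg fun v _ => sq_nonneg _)
  have hcoer : Tendsto (fun W : Unk n m → ℂ => En[W]) (cocompact _) atTop :=
    tendsto_atTop_mono hbound ((tendsto_pow_atTop two_ne_zero).comp tendsto_norm_cocompact_atTop)
  obtain ⟨B, hB, hmin⟩ := hcont.continuousOn.exists_isMinOn' hOc (show A ∈ O from fun μ => rfl)
    ((hcoer.eventually (eventually_ge_atTop (En[A]))).filter_mono inf_le_left)
  exact ⟨B, hB, fun W hW => hmin hW⟩

/-- Every fibre of `Φ = (Φ_μ)_μ` contains a BALANCED tuple: a minimiser of the energy on the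
(closed, `SL_m × SL_m`-stable) fibre satisfies the first-order conditions
`Σ_t B_t B_tᴴ = (E/m)·1 = Σ_t B_tᴴ B_t`. [folklore] -/
private theorem borderGap_exists_balanced (A : Unk n m → ℂ) :
    ∃ B : Unk n m → ℂ,
      (∀ μ, eval B (((pencil n m).det).coeff μ) = eval A (((pencil n m).det).coeff μ)) ∧
      (∑ t, Mat[B, t] * (Mat[B, t])ᴴ) =
          (((En[B]) / m : ℝ) : ℂ) • (1 : Matrix (Fin m) (Fin m) ℂ) ∧
        (∑ t, (Mat[B, t])ᴴ * Mat[B, t]) =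
          (((En[B]) / m : ℝ) : ℂ) • (1 : Matrix (Fin m) (Fin m) ℂ) := by
  obtain ⟨B, hB, hmin⟩ := borderGap_exists_min A
  have hE : (∑ t, ∑ a, ∑ b, ‖Mat[B, t] a b‖ ^ 2) = En[B] := by
    simp only [Fintype.sum_prod_type, Matrix.of_apply]
  have hfam := borderGap_family_balanced (fun t => Mat[B, t]) (fun g hg => ?_) (fun h hh => ?_)
  · rw [hE] at hfam
    exact ⟨B, hB, hfam⟩
  · have h1 := hmin (fun u => (g * Mat[B, u.1]) u.2.1 u.2.2) fun μ => by
      rw [borderGap_phi_lact, hg, one_mul, hB]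
    simpa only [Fintype.sum_prod_type, Matrix.of_apply] using h1
  · have h1 := hmin (fun u => (Mat[B, u.1] * h) u.2.1 u.2.2) fun μ => by
      rw [borderGap_phi_ract, hh, one_mul, hB]
    simpa only [Fintype.sum_prod_type, Matrix.of_apply] using h1

/-- Balance is homogeneous: it is preserved by real scaling of the tuple. [folklore] -/
private theorem borderGap_balanced_smul (W : Unk n m → ℂ) (c : ℝ)
    (h : (∑ t, Mat[W, t] * (Mat[W, t])ᴴ) =
          (((En[W]) / m : ℝ) : ℂ) • (1 : Matrix (Fin m) (Fin m) ℂ) ∧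
        (∑ t, (Mat[W, t])ᴴ * Mat[W, t]) =
          (((En[W]) / m : ℝ) : ℂ) • (1 : Matrix (Fin m) (Fin m) ℂ)) :
    (∑ t, Mat[(c : ℂ) • W, t] * (Mat[(c : ℂ) • W, t])ᴴ) =
        (((En[(c : ℂ) • W]) / m : ℝ) : ℂ) • (1 : Matrix (Fin m) (Fin m) ℂ) ∧
      (∑ t, (Mat[(c : ℂ) • W, t])ᴴ * Mat[(c : ℂ) • W, t]) =
        (((En[(c : ℂ) • W]) / m : ℝ) : ℂ) • (1 : Matrix (Fin m) (Fin m) ℂ) := by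
  have hM : ∀ t, Mat[(c : ℂ) • W, t] = (c : ℂ) • Mat[W, t] := fun t => rfl
  have hE : En[(c : ℂ) • W] = c ^ 2 * En[W] := by
    simp only [Pi.smul_apply, smul_eq_mul, norm_mul, mul_pow, Complex.norm_real, Real.norm_eq_abs,
      sq_abs, Finset.mul_sum]
  have hsc : ((c ^ 2 * En[W] / m : ℝ) : ℂ) = (c : ℂ) * star (c : ℂ) * ((En[W] / m : ℝ) : ℂ) := by
    rw [Complex.star_def, Complex.conj_ofReal]
    push_cast
    ring
  have key : ∀ t, Mat[(c : ℂ) • W, t] * (Mat[(c : ℂ) • W, t])ᴴ =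
      ((c : ℂ) * star (c : ℂ)) • (Mat[W, t] * (Mat[W, t])ᴴ) := fun t => by
    rw [hM, Matrix.conjTranspose_smul, Matrix.smul_mul, Matrix.mul_smul, smul_smul]
  have key' : ∀ t, (Mat[(c : ℂ) • W, t])ᴴ * Mat[(c : ℂ) • W, t] =
      ((c : ℂ) * star (c : ℂ)) • ((Mat[W, t])ᴴ * Mat[W, t]) := fun t => by
    rw [hM, Matrix.conjTranspose_smul, Matrix.smul_mul, Matrix.mul_smul, smul_smul, mul_comm]
  refine ⟨?_, ?_⟩
  · rw [Finset.sum_congr rfl fun t _ => key t, ← Finset.smul_sum, h.1, smul_smul, hE, hsc]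
  · rw [Finset.sum_congr rfl fun t _ => key' t, ← Finset.smul_sum, h.2, smul_smul, hE, hsc]

/-! ## §3 The dichotomy -/

/-- **Stub D1 (border-gap dichotomy; card `balanced-singular-limits`, first lemma).**  If `per_n` is
in the affine border at size `m` then EITHER it has an exact size-`m` affine determinantal
expression, OR there is a sup-norm-one tuple `W = (W₀, (W_e))` of `m × m` matrices that is
BALANCED (`Σ_t W_t W_tᴴ = α·1 = Σ_t W_tᴴ W_t`, the moment-map / Kempf–Ness condition for the
left–right action of `SL_m × SL_m`, which fixes every coefficient of `det(W₀ + Σ x_e W_e)`) and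
spans a SINGULAR matrix space (`det(W₀ + Σ x_e W_e) ≡ 0`).  Proof: minimal-norm points of the
closed fibres of the coefficient map through the approximants (first-order conditions along
transvections and `diag(c, c⁻¹)` ⇒ balanced); bounded minimal norms ⇒ a convergent subsequence ⇒
exact expression; unbounded ⇒ normalise (the coefficients are forms of degree `m` in the tuple) ⇒
singular balanced limit. [folklore] -/
theorem stub_border_gap_dichotomy (n m : ℕ) (hb : InBorder n m) :
    HasDetRepr (perPoly (Fin n) ℂ) m ∨
      ∃ W : Unk n m → ℂ, ‖W‖ = 1 ∧
        (∃ α : ℝ,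
          (∑ t : Option (Fin n × Fin n),
              (Matrix.of fun i j : Fin m => W (t, (i, j))) *
                (Matrix.of fun i j : Fin m => W (t, (i, j)))ᴴ) =
            (α : ℂ) • (1 : Matrix (Fin m) (Fin m) ℂ) ∧
          (∑ t : Option (Fin n × Fin n),
              (Matrix.of fun i j : Fin m => W (t, (i, j)))ᴴ *
                (Matrix.of fun i j : Fin m => W (t, (i, j)))) =
            (α : ℂ) • (1 : Matrix (Fin m) (Fin m) ℂ)) ∧
        ∀ μ : (Fin n × Fin n) →₀ ℕ, eval W (((pencil n m).det).coeff μ) = 0 := by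
  classical
  obtain ⟨A, hA⟩ := hb
  -- `Φ_μ(A k) → coeff_μ per_n`
  have hΦA : ∀ μ, Tendsto (fun k => eval (A k) (((pencil n m).det).coeff μ)) atTop
      (𝓝 (coeff μ (perPoly (Fin n) ℂ))) := by
    intro μ
    have h := (hA μ).add_const (coeff μ (perPoly (Fin n) ℂ))
    rw [zero_add] at h
    refine Tendsto.congr (fun k => ?_) h
    rw [coeff_defect, map_sub, eval_C, sub_add_cancel]
  -- balanced representatives of the fibres through the `A k`
  choose B hBΦ hBl hBr using fun k => borderGap_exists_balanced (A k)
  by_cases hbdd : ∃ R : ℝ, ∀ k, ‖B k‖ ≤ R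
  · -- Case 1: bounded ⇒ convergent subsequence ⇒ exact expression
    left
    obtain ⟨R, hR⟩ := hbdd
    obtain ⟨L, -, ψ, hψ, hL⟩ := (isCompact_closedBall (0 : Unk n m → ℂ) R).tendsto_subseq
      fun k => mem_closedBall_zero_iff.mpr (hR k)
    refine borderGap_hasDetRepr L fun μ => ?_
    have h1 : Tendsto (fun i => eval (B (ψ i)) (((pencil n m).det).coeff μ)) atTop
        (𝓝 (eval L (((pencil n m).det).coeff μ))) :=
      ((MvPolynomial.continuous_eval _).tendsto L).comp hL
    have h2 : Tendsto (fun i => eval (B (ψ i)) (((pencil n m).det).coeff μ)) atTop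
        (𝓝 (coeff μ (perPoly (Fin n) ℂ))) := by
      simp only [hBΦ]
      exact (hΦA μ).comp hψ.tendsto_atTop
    exact tendsto_nhds_unique h1 h2
  · -- Case 2: unbounded ⇒ normalise ⇒ singular balanced limit on the unit sphere
    right
    push Not at hbdd
    have hm : 0 < m := by
      rcases Nat.eq_zero_or_pos m with hm0 | h
      · exfalso
        subst hm0
        obtain ⟨k, hk⟩ := hbdd 0
        have h0 : B k = 0 := Subsingleton.elim _ _
        rw [h0, norm_zero] at hk
        exact lt_irrefl _ hk
      · exact h
    choose φ hφ using fun j : ℕ => hbdd ((j : ℝ) + 1)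
    have hpos : ∀ j, 0 < ‖B (φ j)‖ := fun j => lt_of_le_of_lt (by positivity) (hφ j)
    obtain ⟨V, hV⟩ : ∃ V : ℕ → (Unk n m → ℂ), ∀ j, V j = ((‖B (φ j)‖⁻¹ : ℝ) : ℂ) • B (φ j) :=
      ⟨_, fun j => rfl⟩
    have hV1 : ∀ j, ‖V j‖ = 1 := fun j => by
      rw [hV, norm_smul, Complex.norm_real, norm_inv, norm_norm]
      exact inv_mul_cancel₀ (hpos j).ne'
    have hΦV : ∀ μ, Tendsto (fun j => eval (V j) (((pencil n m).det).coeff μ)) atTop (𝓝 0) := by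
      intro μ
      obtain ⟨K, hK⟩ := (hΦA μ).norm.bddAbove_range
      have hK' : ∀ k, ‖eval (A k) (((pencil n m).det).coeff μ)‖ ≤ K := fun k => hK ⟨k, rfl⟩
      have hlim : Tendsto (fun j : ℕ => 1 / ((j : ℝ) + 1) * K) atTop (𝓝 0) := by
        simpa using tendsto_one_div_add_atTop_nhds_zero_nat.mul_const K
      refine squeeze_zero_norm (fun j => ?_) hlim
      rw [hV, eval_smul_of_isHomogeneous (isHomogeneous_coeff_det_pencil n m μ), norm_mul, norm_pow,
        Complex.norm_real, norm_inv, norm_norm, hBΦ]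
      refine mul_le_mul ?_ (hK' _) (norm_nonneg _) (by positivity)
      have hge1 : 1 ≤ ‖B (φ j)‖ := by
        have := hφ j
        have hj : (0 : ℝ) ≤ j := Nat.cast_nonneg j
        linarith
      calc ‖B (φ j)‖⁻¹ ^ m ≤ ‖B (φ j)‖⁻¹ :=
            pow_le_of_le_one (by positivity) (inv_le_one_of_one_le₀ hge1) hm.ne'
        _ ≤ ((j : ℝ) + 1)⁻¹ := inv_anti₀ (by positivity) (hφ j).le
        _ = 1 / ((j : ℝ) + 1) := (one_div _).symm
    obtain ⟨W, hWmem, ψ, hψ, hW⟩ := (isCompact_sphere (0 : Unk n m → ℂ) 1).tendsto_subseq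
      fun j => mem_sphere_zero_iff_norm.mpr (hV1 j)
    -- continuity of the balance data
    have hMat : ∀ t : Option (Fin n × Fin n), Continuous fun W : Unk n m → ℂ => Mat[W, t] :=
      fun t => continuous_matrix fun i j => continuous_apply _
    have hSL : Continuous fun W : Unk n m → ℂ => ∑ t, Mat[W, t] * (Mat[W, t])ᴴ :=
      continuous_finsetSum _ fun t _ => (hMat t).matrix_mul (hMat t).matrix_conjTranspose
    have hSR : Continuous fun W : Unk n m → ℂ => ∑ t, (Mat[W, t])ᴴ * Mat[W, t] :=
      continuous_finsetSum _ fun t _ => (hMat t).matrix_conjTranspose.matrix_mul (hMat t)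
    have hEn : Continuous fun W : Unk n m → ℂ =>
        (((En[W]) / m : ℝ) : ℂ) • (1 : Matrix (Fin m) (Fin m) ℂ) :=
      (Complex.continuous_ofReal.comp
        ((continuous_finsetSum _ fun u _ => ((continuous_apply u).norm).pow 2).div_const _)).smul
        continuous_const
    have hbalV : ∀ j,
        (∑ t, Mat[V j, t] * (Mat[V j, t])ᴴ) =
            (((En[V j]) / m : ℝ) : ℂ) • (1 : Matrix (Fin m) (Fin m) ℂ) ∧
          (∑ t, (Mat[V j, t])ᴴ * Mat[V j, t]) =
            (((En[V j]) / m : ℝ) : ℂ) • (1 : Matrix (Fin m) (Fin m) ℂ) := fun j => by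
      rw [hV]
      exact borderGap_balanced_smul (B (φ j)) _ ⟨hBl (φ j), hBr (φ j)⟩
    refine ⟨W, mem_sphere_zero_iff_norm.mp hWmem, ⟨En[W] / m, ?_, ?_⟩, fun μ => ?_⟩
    · exact (isClosed_eq hSL hEn).mem_of_tendsto hW
        (Eventually.of_forall fun i => (hbalV (ψ i)).1)
    · exact (isClosed_eq hSR hEn).mem_of_tendsto hW
        (Eventually.of_forall fun i => (hbalV (ψ i)).2)
    · exact tendsto_nhds_unique (((MvPolynomial.continuous_eval _).tendsto W).comp hW)
        ((hΦV μ).comp hψ.tendsto_atTop)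

end Summit.ValiantsHypothesis.ValiantsHypothesis.Theorems.RefutationDegree

end
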